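import Summits.ResolutionOfSingularities.ResolutionOfSingularities.Theorems.FrobeniusLadderFInjectiveMacaulayficationBlowupAlgebraPrimeRealised
import Summits.ResolutionOfSingularities.ResolutionOfSingularities.Theorems.FrobeniusLadderFInjectiveMacaulayficationDegreeZeroDescentLocal
import Literature.AlgebraicGeometry.Resolution.BlowupsCompositionFiniteType
import Literature.AlgebraicGeometry.Resolution.Temkin2008Localization
import Literature.AlgebraicGeometry.Resolution.KollarBlowupSequenceFunctors
import Literature.AlgebraicGeometry.Resolution.StalkIdealGenerization
import Literature.AlgebraicGeometry.Resolution.MarkedIdealsLemmas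
import HarnessLib

/-!
# A good point-supported two-step tower of blowing ups is a `P_loc`-certificate
# (crux `FInjectiveMacaulayfication`, T-𝒫-loc 5h = §T1)

[OURS · L1 W4.5a · res-L1-w45a-stub-3] Support file (`--supports stmt-ResolutionOfSingularities-15315 --as helper`) for the crux
`FrobeniusLadder.FInjectiveMacaulayfication`; NOT a statement of any manuscript; AI-written, weaker than expert review. Statement =
the strategist's sketch file `L/res-L1-w45a-strat-1/PFixTowerSig.lean` r2 sha16 b235fde4a11e66a6, §T1 `stub_pointFixable_of_goodTower`,
VERBATIM with the `stub_` prefix dropped (CRUX-PLAN w45a v11.1 §5 amendment: 5h; ruling R11.16).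

THE THEOREM `pointFixable_of_goodTower`. `X` quasi-compact quasi-separated integral locally Noetherian, `b` a closed point; `π₁` a
blowing up along `J₁` of finite type with `J₁ ≠ ⊥`, `Supp J₁ = {b}`; `π₂` a blowing up of `X'` along `J₂` of finite type, `J₂ ≠ ⊥`,
`Supp J₂ ⊆ π₁⁻¹(b)` (`J₂ = ⊤`: the one-shot case); the full clause (domain ∧ Cohen–Macaulay ∧ Frobenius-closed parameter ideals)
at every point of `X''` over `b`. THEN `PFix (𝒪_{X,b})` (ClassGlueSig v3 74b6a04e74c75940 §5, verbatim): some `𝔪_b`-primary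
`(c) ≠ 0` has all blow-up algebra charts `𝒪_b[(c)/c_j]` satisfying the full clause at their primes over `𝔪_b`. Proof (the Sig's
recipe): Stacks 080B IN THE TREE — `IsBlowup.exists_isBlowup_comp_mul_of_fg` (BlowupsCompositionFiniteType.lean): `π₂ ≫ π₁` is
the blowing up along `J := J₁ · R`, `R` of finite type, `Supp J ⊆ Supp J₁ ∪ π₁(Supp J₂) = {b}`, `b ∈ Supp J` (`J ≤ J₁`); `J ≠ ⊥`
because `X''` is non-empty (`IsBlowup.isIntegral` twice; `IsBlowup.isEmpty_of_bot`); `c :=` generators of the Noetherian stalk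
`J_b` (`Submodule.fg_iff_exists_fin_generating_family`); `(c) ≠ ⊥` (`stalkIdeal_ne_bot_of_ne_bot`); `√(c) = 𝔪_b` because a
prime `q ⊇ J_b` of `𝒪_b` is the point `X.fromSpecStalk b q ∈ Supp J = {b}` (`mem_support_iff_stalkIdeal_le_primeOfSpecializes`,
`primeOfSpecializes_fromSpecStalk`, injectivity of `fromSpecStalk`, `fromSpecStalk_closedPoint`); finally every prime `𝔔` of
`𝒪_b[(c)/c_j]` over `𝔪_b` is the local ring of a point `x'' ∈ X''` over `b` by the reverse dictionary §T0
`BlowupAlgebraPrimeRealised.blowupAlgebra_prime_realised` (p511997), where the clause holds by hypothesis; transport by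
`DegreeZeroDescent.inlineClause_of_ringEquiv`.

References: The Stacks Project, Tags 080B, 0804, 01J7; Görtz–Wedhorn I, Def. 13.90; the rest is folklore.
-/

-- single-problem summit: the doubled namespace component is forced
set_option linter.dupNamespace false

noncomputable section

namespace Summit.ResolutionOfSingularities.ResolutionOfSingularities.Theorems.FInjectiveMacaulayfication.PointFixableOfGoodTower

open AlgebraicGeometry CategoryTheory CategoryTheory.Limits Literature.AlgebraicGeometry.Resolution TopologicalSpace IsLocalRing
open Summit.ResolutionOfSingularities.ResolutionOfSingularities.Theorems.FInjectiveMacaulayfication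

set_option maxHeartbeats 800000 in
-- the ∃-packaged clause elaborates large terms
/-- **5h = §T1 — A GOOD TWO-STEP POINT-SUPPORTED TOWER IS A `P_loc`-CERTIFICATE** (`PFixTowerSig` r2 b235fde4a11e66a6
`stub_pointFixable_of_goodTower`, verbatim). [cite: StacksProject, Tag 080B] -/
theorem pointFixable_of_goodTower : ∀ (p : ℕ) (X : Scheme.{0}) [CompactSpace X] [QuasiSeparatedSpace X] [IsIntegral X]
    [IsLocallyNoetherian X] (b : X), IsClosed ({b} : Set X) →
    ∀ (J₁ : X.IdealSheafData), (∀ U : X.affineOpens, (J₁.ideal U).FG) → J₁ ≠ ⊥ → (J₁.support : Set X) = {b} →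
    ∀ (X' : Scheme.{0}) (π₁ : X' ⟶ X), IsBlowup π₁ J₁ →
    ∀ (J₂ : X'.IdealSheafData), (∀ U : X'.affineOpens, (J₂.ideal U).FG) → J₂ ≠ ⊥ → (J₂.support : Set X') ⊆ π₁.base ⁻¹' {b} →
    ∀ (X'' : Scheme.{0}) (π₂ : X'' ⟶ X'), IsBlowup π₂ J₂ →
    (∀ x'' : X'', π₁.base (π₂.base x'') = b → IsDomain (X''.presheaf.stalk x'') ∧ ∀ d : ℕ, ringKrullDim (X''.presheaf.stalk x'') = d → ∀ s : Fin d → X''.presheaf.stalk x'', (Ideal.span (Set.range s)).radical.IsMaximal → RingTheory.Sequence.IsWeaklyRegular (X''.presheaf.stalk x'') (List.ofFn s) ∧ ∀ y : X''.presheaf.stalk x'', (∃ e : ℕ, y ^ p ^ e ∈ Ideal.span ((fun z : X''.presheaf.stalk x'' => z ^ p ^ e) '' (Ideal.span (Set.range s) : Set (X''.presheaf.stalk x'')))) → y ∈ Ideal.span (Set.range s)) →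
    (∃ (n : ℕ) (c : Fin n → X.presheaf.stalk b), Ideal.span (Set.range c) ≠ ⊥ ∧ (Ideal.span (Set.range c)).radical = IsLocalRing.maximalIdeal (X.presheaf.stalk b) ∧
        ∀ (j : Fin n) (𝔔 : PrimeSpectrum (Literature.AlgebraicGeometry.Resolution.blowupAlgebra (Ideal.span (Set.range c)) (c j))),
          𝔔.asIdeal.comap (algebraMap (X.presheaf.stalk b) (Literature.AlgebraicGeometry.Resolution.blowupAlgebra (Ideal.span (Set.range c)) (c j))) = IsLocalRing.maximalIdeal (X.presheaf.stalk b) →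
          IsDomain (Localization.AtPrime 𝔔.asIdeal) ∧ ∀ d : ℕ, ringKrullDim (Localization.AtPrime 𝔔.asIdeal) = d → ∀ s : Fin d → Localization.AtPrime 𝔔.asIdeal, (Ideal.span (Set.range s)).radical.IsMaximal → RingTheory.Sequence.IsWeaklyRegular (Localization.AtPrime 𝔔.asIdeal) (List.ofFn s) ∧ ∀ y : Localization.AtPrime 𝔔.asIdeal, (∃ e : ℕ, y ^ p ^ e ∈ Ideal.span ((fun z : Localization.AtPrime 𝔔.asIdeal => z ^ p ^ e) '' (Ideal.span (Set.range s) : Set (Localization.AtPrime 𝔔.asIdeal)))) → y ∈ Ideal.span (Set.range s)) := by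
  intro p X _ _ _ _ b hb J₁ hJ₁fg hJ₁ hsupp₁ X' π₁ hπ₁ J₂ hJ₂fg hJ₂ hsupp₂ X'' π₂ hπ₂ hgood
  classical
  -- Stacks 080B: the composite is the blowing up along `J := J₁ · R`, `R` of finite type
  obtain ⟨R, hRfg, hπ, hsuppJ⟩ := hπ₁.exists_isBlowup_comp_mul_of_fg hJ₁fg hπ₂ hJ₂fg
  have hJfg : ∀ U : X.affineOpens, ((J₁ * R).ideal U).FG := fun U => by
    rw [Scheme.IdealSheafData.ideal_mul, Pi.mul_apply]
    exact (hJ₁fg U).mul (hRfg U)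
  -- `Supp J ⊆ {b}` and `b ∈ Supp J`
  have hsub : ((J₁ * R).support : Set X) ⊆ {b} := by
    intro y hy
    rcases hsuppJ hy with h | ⟨y', hy', rfl⟩
    · rwa [hsupp₁] at h
    · exact hsupp₂ hy'
  have hle : J₁ * R ≤ J₁ := Scheme.IdealSheafData.le_def.mpr fun U => by
    rw [Scheme.IdealSheafData.ideal_mul, Pi.mul_apply]
    exact Ideal.mul_le_right
  have hbJ : b ∈ ((J₁ * R).support : Set X) := by
    have h1 : b ∈ (J₁.support : Set X) := by rw [hsupp₁]; exact Set.mem_singleton b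
    exact Scheme.IdealSheafData.support_antitone hle h1
  -- `J ≠ ⊥`: the source `X''` of the blowing up along `J` is non-empty
  haveI : IsIntegral X' := hπ₁.isIntegral hJ₁
  haveI : IsIntegral X'' := hπ₂.isIntegral hJ₂
  have hJ : J₁ * R ≠ ⊥ := by
    intro h0
    rw [h0] at hπ
    exact (IsBlowup.isEmpty_of_bot hπ).false (Classical.arbitrary X'')
  -- generators `c` of the Noetherian stalk `J_b`
  obtain ⟨n, c, hc⟩ := Submodule.fg_iff_exists_fin_generating_family.mp
    (IsNoetherian.noetherian (stalkIdeal (J₁ * R) b))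
  have hc' : stalkIdeal (J₁ * R) b = Ideal.span (Set.range c) := hc.symm
  refine ⟨n, c, ?_, ?_, ?_⟩
  · -- `(c) ≠ ⊥`
    rw [← hc']
    exact stalkIdeal_ne_bot_of_ne_bot hJ b
  · -- `√(c) = 𝔪_b`
    rw [← hc']
    apply le_antisymm
    · exact (Ideal.IsMaximal.isPrime (maximalIdeal.isMaximal _)).radical_le_iff.mpr
        ((mem_support_iff_stalkIdeal_le _ b).mp hbJ)
    · intro a ha
      rw [Ideal.radical_eq_sInf, Submodule.mem_sInf]
      rintro q ⟨hIq, hq⟩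
      haveI := hq
      -- the generisation of `b` defined by `q` lies in `Supp J = {b}`, so `q = 𝔪_b`
      have hζ : X.fromSpecStalk b ⟨q, hq⟩ ∈ (J₁ * R).support := by
        rw [mem_support_iff_stalkIdeal_le_primeOfSpecializes (fromSpecStalk_specializes ⟨q, hq⟩),
          primeOfSpecializes_fromSpecStalk]
        exact hIq
      have hζb : X.fromSpecStalk b ⟨q, hq⟩ = X.fromSpecStalk b (closedPoint (X.presheaf.stalk b)) := by
        rw [Scheme.fromSpecStalk_closedPoint]
        exact Set.mem_singleton_iff.mp (hsub hζ)
      have hqm : (⟨q, hq⟩ : PrimeSpectrum (X.presheaf.stalk b)) = closedPoint (X.presheaf.stalk b) :=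
        (X.fromSpecStalk b).isEmbedding.injective hζb
      have hq' : q = maximalIdeal (X.presheaf.stalk b) := congrArg PrimeSpectrum.asIdeal hqm
      rw [hq']
      exact ha
  · -- the clause at a prime `𝔔` of `𝒪_b[(c)/c_j]` over `𝔪_b`: realise it as a point of `X''` over `b` (§T0)
    intro j 𝔔 h𝔔
    obtain ⟨x'', hx'', ⟨e⟩⟩ := BlowupAlgebraPrimeRealised.blowupAlgebra_prime_realised X X'' (π₂ ≫ π₁) (J₁ * R)
      hJfg hπ b n c hc' j 𝔔 h𝔔
    have hb'' : π₁.base (π₂.base x'') = b := by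
      rw [← Scheme.Hom.comp_apply]
      exact hx''
    obtain ⟨hdom, hcl⟩ := hgood x'' hb''
    haveI := hdom
    exact ⟨MulEquiv.isDomain (X''.presheaf.stalk x'') e.symm.toMulEquiv,
      DegreeZeroDescent.inlineClause_of_ringEquiv (L := X''.presheaf.stalk x'') (L' := Localization.AtPrime 𝔔.asIdeal) p e hcl⟩

end Summit.ResolutionOfSingularities.ResolutionOfSingularities.Theorems.FInjectiveMacaulayfication.PointFixableOfGoodTower

end
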